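import Summits.BirchSwinnertonDyer.BirchSwinnertonDyer.Theorems.ResidualThetaTransportAtTwoSignedMuVanishingAtTwoPlusOldClassFlat
import HarnessLib

/-!
# Route `ResidualThetaTransportAtTwo`, crux Kμ⁺ `SignedMuVanishingAtTwoPlus` (stmt-BirchSwinnertonDyer-20689),
# line `birth`, stub `stub_flatMuZeroAtTwo`: two tools of the old-class descent — complex conjugation on periods, and
# «vanishing dilation sums kill the residual certificate»

Cell `bsd-wall`, width seat `bsd-wall-rtt-p4-w2` (g3). THEOREMS ONLY (no `def`, no named fact, no `sorry`); helper
`--supports` the crux; sequel of `…OldClassFlat`, used by `…OldClassCongruence`. BSD is not proved by this.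

* `cuspSymbol_eq_conj_of_apply` — for `f` with real coefficients and `γ, γ' ∈ Γ₀(N)` with equal `(0,0)` and opposite `(1,0)`
  entries (`γ' = εγε`), `{∞, γ'∞}_f = conj {∞, γ∞}_f` (so the doubled real periods are EVEN under `ε`-conjugation).
* `no_odd_of_sum_even` — for a rational newform `g` of odd level with `a₂(g)` even and `S ≠ ∅` finite odd: if
  `∑_{t∈S} 2([tb/4^k]⁺_g − [0]⁺_g) ∈ 2ℤ` for all `k ≥ 1`, `b` odd, then no `2([b/4^k]⁺_g − [0]⁺_g)` is odd — the transport
  lemma `OldClassTransport.eq_zero_of_sum_dilations_eq_zero` (p597310) on `F_k(b) = 2([b/4^k]⁺_g − [0]⁺_g) mod 2`. Hence an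
  old class `∑_t χ_g ∘ δ_t` of a residually FLAT `g` is never zero (no Ihara lemma needed).

References: M. Emerton, R. Pollack, T. Weston, Invent. Math. 163 (2006) Lemma 4.4.4 [EmertonPollackWeston2006]; B. Mazur,
J. Tate, J. Teitelbaum, Invent. Math. 84 (1986) §I.4 (4.2) [MazurTateTeitelbaum1986Invent]; J. E. Cremona, *Algorithms for
modular elliptic curves* (1997) §2.6, §2.8 [CremonaAlgorithms1997]; Ju. I. Manin (1972) §1.6 [Manin1972].
-/


set_option autoImplicit false
set_option linter.dupNamespace false

noncomputable section

open scoped Classical MatrixGroups ModularForm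

open CongruenceSubgroup WeierstrassCurve Literature.NumberTheory.EllipticCurves
  Literature.NumberTheory.EllipticCurves.ModularForms Literature.NumberTheory.EllipticCurves.Rank1Residual
  Literature.NumberTheory.IwasawaTheory Summit.BirchSwinnertonDyer.Rank1Residual.Supersingular
  Summit.BirchSwinnertonDyer.BirchSwinnertonDyer.Theses.ResidualThetaTransportAtTwo

namespace Summit.BirchSwinnertonDyer.BirchSwinnertonDyer.Theorems.SignedMuAtTwo

/-! ## §1. Tools: complex conjugation on periods; the residual certificate is killed by vanishing dilation sums -/

section Tools

variable {N : ℕ} [NeZero N] (f : CuspForm (Gamma0 N) 2)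

/-- **Complex conjugation on periods**: for `f` with real coefficients and `γ, γ' ∈ Γ₀(N)` with the same `(0,0)` entry and
opposite `(1,0)` entries (`γ' = εγε`, `ε = diag(−1,1)`, up to the irrelevant entries), `{∞, γ'∞}_f = conj {∞, γ∞}_f`
(`γ'∞ = −γ∞`, `{∞, −r}_f = conj{∞, r}_f`). [cite: CremonaAlgorithms1997, §2.6] [cite: Manin1972, §1.6] -/
theorem cuspSymbol_eq_conj_of_apply (hreal : ∀ n, (cuspCoeff f n).im = 0) (γ γ' : Gamma0 N)
    (h00 : (γ' : SL(2, ℤ)) 0 0 = (γ : SL(2, ℤ)) 0 0) (h10 : (γ' : SL(2, ℤ)) 1 0 = -((γ : SL(2, ℤ)) 1 0)) :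
    cuspSymbol f γ' = starRingEnd ℂ (cuspSymbol f γ) := by
  unfold cuspSymbol
  rw [h00, h10]
  by_cases hc : (γ : SL(2, ℤ)) 1 0 = 0
  · rw [if_pos hc, if_pos (neg_eq_zero.mpr hc), map_zero]
  · rw [if_neg hc, if_neg (neg_eq_zero.not.mpr hc), ← modularSymbol_neg_eq_conj_holds f hreal, Int.cast_neg, div_neg]

/-- **Vanishing dilation sums kill the residual certificate.** For a normalised newform `g` of odd level with rational
coefficients and `a₂(g) = a` even, and `S ≠ ∅` finite odd: if `∑_{t∈S} 2([tb/4^k]⁺_g − [0]⁺_g) ∈ 2ℤ` for all `k ≥ 1`, `b` odd,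
then NO `2([b/4^k]⁺_g − [0]⁺_g)` (`k ≥ 1`, `b` odd) is odd — the transport lemma `OldClassTransport.eq_zero_of_sum_dilations_eq_zero`
applied to `F_k(b) = 2([b/4^k]⁺_g − [0]⁺_g) mod 2` (as in `exists_odd_of_plusSymbol_congruence`).
[cite: EmertonPollackWeston2006, Lemma 4.4.4] [cite: MazurTateTeitelbaum1986Invent, §I.4 (4.2)] -/
theorem no_odd_of_sum_even {N₀ : ℕ} [NeZero N₀] (g : CuspForm (Gamma0 N₀) 2) (hg : IsNewform0 g)
    (hQg : coeffField g = ⊥) (h2N₀ : ¬ 2 ∣ N₀) {a : ℤ} (ha : cuspCoeff g 2 = a) (haev : Even a)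
    (S : Finset ℕ) (hS : S.Nonempty) (hodd : ∀ t ∈ S, Odd t)
    (hsum : ∀ k : ℕ, 1 ≤ k → ∀ b : ℤ, Odd b → ∃ z : ℤ,
      ∑ t ∈ S, 2 * (ratPlusSymbol g ((((t : ℤ) * b : ℤ) : ℚ) / 4 ^ k) - ratPlusSymbol g 0) = 2 * z)
    {k : ℕ} (hk : 1 ≤ k) {b : ℤ} (hb : Odd b) {m : ℤ} (hmo : Odd m)
    (hm : ratPlusSymbol g ((b : ℚ) / 4 ^ k) = ratPlusSymbol g 0 + (m : ℚ) / 2) : False := by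
  have hrealg : ∀ n, (cuspCoeff g n).im = 0 := cuspCoeff_im_eq_zero_of_coeffField_eq_bot hQg
  set Mg : ℚ → ℚ := fun x ↦ 2 * (ratPlusSymbol g x - ratPlusSymbol g 0) with hMg
  have hMg_int : ∀ (c : ℤ) (j : ℕ), ∃ m : ℤ, Mg ((c : ℚ) / 2 ^ j) = m := fun c j ↦
    exists_two_mul_ratPlusSymbol_sub_eq_intCast g hrealg (coprime_den_div_two_pow h2N₀ c j)
  set F : ℕ → ℤ → ZMod 2 := fun k b ↦ (((Mg ((b : ℚ) / 4 ^ k)).num : ℤ) : ZMod 2) with hF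
  have h4pow : ∀ k : ℕ, ((4 : ℚ) ^ k) = 2 ^ (2 * k) := fun k ↦ by rw [pow_mul]; norm_num
  have hFval : ∀ (k : ℕ) (b m : ℤ), Mg ((b : ℚ) / 4 ^ k) = m → F k b = (m : ZMod 2) := by
    intro k b m h
    show (((Mg ((b : ℚ) / 4 ^ k)).num : ℤ) : ZMod 2) = (m : ZMod 2)
    rw [h, Rat.num_intCast]
  have hMg_int4 : ∀ (k : ℕ) (b : ℤ), ∃ m : ℤ, Mg ((b : ℚ) / 4 ^ k) = m := by
    intro k b; rw [h4pow]; exact hMg_int b (2 * k)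
  have hcast : ∀ (q₁ q₂ q₃ : ℚ) (m₁ m₂ m₃ m₄ e : ℤ), q₁ = m₁ → q₂ = m₂ → q₃ = m₃ →
      q₁ + q₂ + q₃ = (a : ℚ) * m₄ + e →
      (m₁ : ZMod 2) + (m₂ : ZMod 2) + (m₃ : ZMod 2) = (e : ZMod 2) := by
    intro q₁ q₂ q₃ m₁ m₂ m₃ m₄ e h1 h2 h3 h
    rw [h1, h2, h3] at h
    have hZ : m₁ + m₂ + m₃ = a * m₄ + e := by exact_mod_cast h
    obtain ⟨r, hr⟩ := haev
    have : (m₁ : ZMod 2) + m₂ + m₃ = ((a * m₄ + e : ℤ) : ZMod 2) := by rw [← hZ]; push_cast; ring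
    rw [this, hr]; push_cast
    have h2 : (r : ZMod 2) + r = 0 := by rw [← two_mul]; exact mul_eq_zero_of_left (by decide) _
    linear_combination (m₄ : ZMod 2) * h2
  obtain ⟨e, he⟩ : ∃ e : ℤ, Mg (1 / 2) = e := by
    have h := hMg_int 1 1
    rwa [show ((1 : ℤ) : ℚ) / 2 ^ 1 = 1 / 2 by norm_num] at h
  have hper : ∀ k, Function.Periodic (F k) ((4 : ℤ) ^ k) := by
    intro k b
    show (((2 * (ratPlusSymbol g (((b + 4 ^ k : ℤ) : ℚ) / 4 ^ k) - ratPlusSymbol g 0)).num : ℤ) : ZMod 2) =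
      (((2 * (ratPlusSymbol g ((b : ℚ) / 4 ^ k) - ratPlusSymbol g 0)).num : ℤ) : ZMod 2)
    have : (((b + 4 ^ k : ℤ) : ℚ) / 4 ^ k) = (b : ℚ) / 4 ^ k + ((1 : ℤ) : ℚ) := by
      push_cast; field_simp
    rw [this, ratPlusSymbol_add_intCast_holds]
  have heven : ∀ k (b : ℤ), F k (-b) = F k b := by
    intro k b
    show (((Mg (((-b : ℤ) : ℚ) / 4 ^ k)).num : ℤ) : ZMod 2) = (((Mg ((b : ℚ) / 4 ^ k)).num : ℤ) : ZMod 2)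
    have : (((-b : ℤ) : ℚ) / 4 ^ k) = -((b : ℚ) / 4 ^ k) := by push_cast; ring
    rw [this, hMg]
    simp only [ratPlusSymbol_neg]
  have hdist : ∀ k, 1 ≤ k → ∀ b : ℤ, Odd b → F k b + F (k + 1) b + F (k + 1) (b + 2 ^ (2 * k + 1)) =
      (e : ZMod 2) := by
    intro k _ b _
    set x : ℚ := (b : ℚ) / 2 ^ (2 * k + 1) with hx
    obtain ⟨m₁, hm₁⟩ := hMg_int4 (k + 1) b
    obtain ⟨m₂, hm₂⟩ := hMg_int4 (k + 1) (b + 2 ^ (2 * k + 1))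
    obtain ⟨m₃, hm₃⟩ := hMg_int4 k b
    obtain ⟨m₄, hm₄⟩ := hMg_int b (2 * k + 1)
    have hd := distribution_two_mul_ratPlusSymbol_sub g hg hQg h2N₀ ha x
    have e1 : x / 2 = (b : ℚ) / 4 ^ (k + 1) := by
      rw [hx, h4pow]; field_simp; ring
    have e2 : (x + 1) / 2 = ((b + 2 ^ (2 * k + 1) : ℤ) : ℚ) / 4 ^ (k + 1) := by
      rw [hx, h4pow]; push_cast; field_simp; ring
    have e3 : 2 * x = (b : ℚ) / 4 ^ k := by
      rw [hx, h4pow]; field_simp; ring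
    rw [e1, e2, e3] at hd
    rw [hFval _ _ _ hm₃, hFval _ _ _ hm₁, hFval _ _ _ hm₂]
    have := hcast _ _ _ m₁ m₂ m₃ m₄ e hm₁ hm₂ hm₃ (by rw [← hm₄, ← he]; exact hd)
    linear_combination this
  have hdist0 : ∀ b : ℤ, Odd b → F 1 b + F 1 (b + 2) = (e : ZMod 2) := by
    intro b _
    set x : ℚ := (b : ℚ) / 2 with hx
    obtain ⟨m₁, hm₁⟩ := hMg_int4 1 b
    obtain ⟨m₂, hm₂⟩ := hMg_int4 1 (b + 2)
    obtain ⟨m₄, hm₄⟩ := hMg_int b 1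
    have hd := distribution_two_mul_ratPlusSymbol_sub g hg hQg h2N₀ ha x
    have e1 : x / 2 = (b : ℚ) / 4 ^ 1 := by rw [hx]; ring
    have e2 : (x + 1) / 2 = ((b + 2 : ℤ) : ℚ) / 4 ^ 1 := by rw [hx]; push_cast; ring
    have e3 : Mg (2 * x) = ((0 : ℤ) : ℚ) := by
      rw [hx, hMg]
      simp only
      rw [show (2 : ℚ) * ((b : ℚ) / 2) = 0 + ((b : ℤ) : ℚ) by ring, ratPlusSymbol_add_intCast_holds]
      push_cast; ring
    rw [e1, e2] at hd
    rw [hFval _ _ _ hm₁, hFval _ _ _ hm₂]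
    have := hcast _ _ _ m₁ m₂ 0 m₄ e hm₁ hm₂ e3 (by rw [pow_one] at hm₄; rw [← hm₄, ← he]; exact hd)
    simpa using this
  have hkill : ∀ k, 1 ≤ k → ∀ b : ℤ, Odd b → ∑ t ∈ S, F k (t * b) = 0 := by
    intro k hk b hb
    obtain ⟨z, hz⟩ := hsum k hk b hb
    choose mm hmm using fun t : ℕ ↦ hMg_int4 k ((t : ℤ) * b)
    have hmm' : ∀ t : ℕ, 2 * (ratPlusSymbol g ((((t : ℤ) * b : ℤ) : ℚ) / 4 ^ k) - ratPlusSymbol g 0) = mm t := by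
      intro t; have h := hmm t; rw [hMg] at h; exact h
    have hsum' : ∑ t ∈ S, F k (t * b) = ((∑ t ∈ S, mm t : ℤ) : ZMod 2) := by
      push_cast
      exact Finset.sum_congr rfl fun t _ ↦ hFval k _ _ (hmm t)
    have hZ : (∑ t ∈ S, (mm t : ℚ)) = 2 * z := by
      rw [← hz]
      exact Finset.sum_congr rfl fun t _ ↦ (hmm' t).symm
    have hZ' : ∑ t ∈ S, mm t = 2 * z := by exact_mod_cast hZ
    rw [hsum', hZ']; push_cast
    have h2 : (2 : ZMod 2) = 0 := by decide
    rw [h2, zero_mul]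
  have hzero := OldClassTransport.eq_zero_of_sum_dilations_eq_zero F (e : ZMod 2) hper heven hdist hdist0 S hS
    hodd hkill
  have hMgm : Mg ((b : ℚ) / 4 ^ k) = m := by rw [hMg]; simp only; rw [hm]; ring
  have h1 := hzero k hk b hb
  rw [hFval k b m hMgm] at h1
  obtain ⟨r, hr⟩ := hmo
  rw [hr] at h1; push_cast at h1
  have h2 : (2 : ZMod 2) = 0 := by decide
  rw [h2, zero_mul, zero_add] at h1
  exact one_ne_zero h1

end Tools

end Summit.BirchSwinnertonDyer.BirchSwinnertonDyer.Theorems.SignedMuAtTwo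

end
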